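import Mathlib
import HarnessLib
import Literature.Analysis.FluidPDE.VectorCalculus

/-!
# `FilamentPinchDoor.FilamentPinchLiouville` (stmt-NavierStokesRegularity-26430) — the TERMINAL WINDOWED CIRCULATION
# exists (helper for the research stub `stub_noTerminalMass`, skeleton r4, line `birth`)

The windowed Kelvin law (registered stub `stub_frozenFlux`, landed p623029) says that every scale-normalised
windowed circulation `Ψ_L(a,τ) = L⁻¹ ∫ ⟪curl v(τ,y), e⟫ φ((y−a)/L) dy` of a Type-I profile of the energy class is
`K₂/L²`-Lipschitz in `τ < 0`.  Consequently (`exists_tendsto_terminal_of_kelvinLaw`) it has a TERMINAL VALUE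
`T(φ,a,L) = lim_{τ→0⁻} Ψ_L(a,τ)` with the rate `|Ψ_L(a,s) − T(φ,a,L)| ≤ K₂(−s)/L²`: the far-field circulation of
every slice is the terminal one up to `O((−s)/L²)`.  The remaining research stub `stub_noTerminalMass` of crux 26430
is literally `T ≡ 0` for backward-singular one-signed profiles; `T ≥ 0` and `T(φ,a,·)` inherits the linear growth bound
when the component is one-signed, so `T` is (the window transform of) a non-negative Radon measure of 1-dimensional
growth on `ℝ³` — the terminal filament.

* `exists_tendsto_of_forall_abs_sub_le` — a real function `Ψ` on `(−∞,0)` with `|Ψ t − Ψ s| ≤ M(t − s)` for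
  `s < t < 0` has a limit `T` at `0⁻` with `|Ψ s − T| ≤ M(−s)` (Cauchy criterion);
* `exists_tendsto_terminal_of_kelvinLaw` — the same for the windowed circulations, from the Kelvin-law hypothesis in
  the registered form.

HONEST FRAMING: bookkeeping about HYPOTHETICAL Type-I blow-up profiles; nothing here bears on Navier–Stokes regularity;
no summit statement is proved.
-/

noncomputable section

-- the summit and its single sub-problem share the name (CONVENTIONS §1), as in every Theorems file
set_option linter.dupNamespace false

namespace Summit.NavierStokesRegularity.NavierStokesRegularity.Theorems.FilamentPinchDoorFilamentPinchLiouvilleTerminalMass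

open Set Function Filter MeasureTheory Metric Topology InnerProductSpace
open scoped RealInnerProductSpace
open Literature.Analysis Literature.Analysis.FluidPDE

/-! ### A one-sided Lipschitz-in-time function has a terminal value -/

/-- **Terminal value with rate.**  If `|Ψ t − Ψ s| ≤ M (t − s)` for all `s < t < 0`, then `Ψ` has a limit `T` as
`t → 0⁻` and `|Ψ s − T| ≤ M(−s)` for every `s < 0` (Cauchy criterion in `ℝ`). [folklore] -/
theorem exists_tendsto_of_forall_abs_sub_le {Ψ : ℝ → ℝ} {M : ℝ}
    (h : ∀ s t : ℝ, s < t → t < 0 → |Ψ t - Ψ s| ≤ M * (t - s)) :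
    ∃ T : ℝ, Tendsto Ψ (𝓝[<] (0 : ℝ)) (𝓝 T) ∧ ∀ s < 0, |Ψ s - T| ≤ M * (-s) := by
  -- `M ≥ 0` unless the hypothesis is vacuous... it is not: take `s = -2, t = -1`
  have hM : 0 ≤ M := by
    have := h (-2) (-1) (by norm_num) (by norm_num)
    have h0 : (0 : ℝ) ≤ |Ψ (-1) - Ψ (-2)| := abs_nonneg _
    linarith
  -- symmetric form of the hypothesis on `(−∞,0)`
  have hsym : ∀ s t : ℝ, s < 0 → t < 0 → |Ψ t - Ψ s| ≤ M * |t - s| := by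
    intro s t hs ht
    rcases lt_trichotomy s t with hst | rfl | hts
    · rw [abs_of_pos (sub_pos.2 hst)]; exact h s t hst ht
    · simp
    · calc |Ψ t - Ψ s| = |Ψ s - Ψ t| := abs_sub_comm _ _
        _ ≤ M * (s - t) := h t s hts hs
        _ = M * |t - s| := by rw [abs_sub_comm, abs_of_pos (sub_pos.2 hts)]
  -- Cauchy criterion for the filter `map Ψ (𝓝[<] 0)`
  have hne : (𝓝[<] (0 : ℝ)).NeBot := inferInstance
  have hC : Cauchy (map Ψ (𝓝[<] (0 : ℝ))) := by
    rw [Metric.cauchy_iff]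
    refine ⟨hne.map Ψ, fun ε hε => ?_⟩
    set δ : ℝ := ε / (2 * (M + 1)) with hδ
    have hδpos : 0 < δ := by rw [hδ]; positivity
    refine ⟨Ψ '' Ioo (-δ) 0, ?_, ?_⟩
    · exact image_mem_map (Ioo_mem_nhdsLT (by linarith))
    · rintro _ ⟨t, ht, rfl⟩ _ ⟨s, hs, rfl⟩
      rw [Real.dist_eq]
      have hts : |t - s| ≤ δ := by
        rw [abs_le]; constructor <;> linarith [ht.1, ht.2, hs.1, hs.2]
      calc |Ψ t - Ψ s| ≤ M * |t - s| := hsym s t hs.2 ht.2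
        _ ≤ M * δ := mul_le_mul_of_nonneg_left hts hM
        _ < ε := by
            rw [hδ]
            have : M * (ε / (2 * (M + 1))) = ε * (M / (2 * (M + 1))) := by ring
            rw [this]
            have hlt : M / (2 * (M + 1)) < 1 := by
              rw [div_lt_one (by positivity)]; linarith
            nlinarith
  obtain ⟨T, hT⟩ := CompleteSpace.complete hC
  have hTend : Tendsto Ψ (𝓝[<] (0 : ℝ)) (𝓝 T) := hT
  refine ⟨T, hTend, fun s hs => ?_⟩
  -- pass to the limit `t → 0⁻` in `|Ψ t − Ψ s| ≤ M (t − s)`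
  have h1 : Tendsto (fun t => |Ψ t - Ψ s|) (𝓝[<] (0 : ℝ)) (𝓝 |T - Ψ s|) := (hTend.sub_const (Ψ s)).abs
  have h2 : Tendsto (fun t : ℝ => M * (t - s)) (𝓝[<] (0 : ℝ)) (𝓝 (M * (0 - s))) :=
    ((tendsto_nhdsWithin_of_tendsto_nhds tendsto_id).sub_const s).const_mul M
  have h3 : ∀ᶠ t in 𝓝[<] (0 : ℝ), |Ψ t - Ψ s| ≤ M * (t - s) := by
    filter_upwards [Ioo_mem_nhdsLT hs] with t ht
    exact h s t ht.1 ht.2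
  have := le_of_tendsto_of_tendsto h1 h2 h3
  rw [abs_sub_comm]
  simpa using this

/-! ### The terminal windowed circulation of a profile obeying the windowed Kelvin law -/

/-- **The terminal windowed circulation exists.**  If the windowed circulations of `v` along `e` against the window
`φ` obey the Kelvin law `|Ψ_L(a,t) − Ψ_L(a,s)| ≤ K₂(t−s)/L²` (`s<t<0`; the registered conclusion of `stub_frozenFlux`),
then for every `L > 0` and `a` the terminal value `T = lim_{t→0⁻} Ψ_L(a,t)` exists and
`|Ψ_L(a,s) − T| ≤ K₂(−s)/L²` for all `s < 0`. [folklore] -/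
theorem exists_tendsto_terminal_of_kelvinLaw {v : ℝ → EuclideanSpace ℝ (Fin 3) → EuclideanSpace ℝ (Fin 3)}
    {e : EuclideanSpace ℝ (Fin 3)} {φ : EuclideanSpace ℝ (Fin 3) → ℝ} {K₂ : ℝ}
    (hK : ∀ L : ℝ, 0 < L → ∀ (a : EuclideanSpace ℝ (Fin 3)) (s t : ℝ), s < t → t < 0 →
      |(L⁻¹ * ∫ y, ⟪curl (v t) y, e⟫ * φ (L⁻¹ • (y - a))) -
        (L⁻¹ * ∫ y, ⟪curl (v s) y, e⟫ * φ (L⁻¹ • (y - a)))| ≤ K₂ * (t - s) / L ^ 2)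
    {L : ℝ} (hL : 0 < L) (a : EuclideanSpace ℝ (Fin 3)) :
    ∃ T : ℝ, Tendsto (fun t : ℝ => L⁻¹ * ∫ y, ⟪curl (v t) y, e⟫ * φ (L⁻¹ • (y - a))) (𝓝[<] (0 : ℝ)) (𝓝 T) ∧
      ∀ s < 0, |(L⁻¹ * ∫ y, ⟪curl (v s) y, e⟫ * φ (L⁻¹ • (y - a))) - T| ≤ K₂ / L ^ 2 * (-s) := by
  refine exists_tendsto_of_forall_abs_sub_le (M := K₂ / L ^ 2) fun s t hst ht0 => ?_
  have := hK L hL a s t hst ht0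
  calc _ ≤ K₂ * (t - s) / L ^ 2 := this
    _ = K₂ / L ^ 2 * (t - s) := by ring

end Summit.NavierStokesRegularity.NavierStokesRegularity.Theorems.FilamentPinchDoorFilamentPinchLiouvilleTerminalMass

end
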